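import Literature.IUT.LogThetaLattice.PacketLogVolumesHaarModelCapsulesGeneral
import Literature.IUT.LogVolume.TensorPacketTransport
import Literature.IUT.LogVolume.ArchimedeanPacketLogVolumeInvariance
import HarnessLib

/-!
# [IUTchIII] Proposition 3.9 (i)/(iii) for CAPSULES at the genuine model, IV: invariance of `μ^log_{A,v_ℚ}` and
# `μ^log_{A,𝕍_ℚ}` under PERMUTATIONS of the label set `A` (abc-iut cell, layer L6, row «CAP39»)

S. Mochizuki, *Inter-universal Teichmüller theory III*, kurims manuscript (May 2020) [claim: Mochizuki2012, status:
disputed]. Proposition 3.9 (i), p. 116: "By applying Proposition 3.5, (i), to arbitrary elements as opposed to capsules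
— we conclude that `μ^log_{A,v_ℚ}` is invariant with respect to permutations of `A`"; (iii), p. 117: the global
log-volume `μ^log_{A,𝕍_ℚ}` "is invariant with respect to multiplication by elements of `(†𝕄⊛_mod)_α` … as well as with
respect to permutations of `A`". Dupuy–Hilado, arXiv:2004.13228, §4.7 "(Ind1)": the factor permutation on
`K_{v̲_0} ⊗ ⋯ ⊗ K_{v̲_j}` "fixes the lattice". [IUTchIV] Prop. 1.5 (iii) p. 15 (archimedean: the direct sum
decomposition of `M_I` is unique, hence its log-volume intrinsic).

WHAT THIS FILE ADDS (over part II `PacketLogVolumesHaarModelCapsulesGeneral.lean`: `μ^log_{A,v_ℚ}` =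
`capsulePacketLogVolume F A q` on GENUINE regions of the portions `⊗_α F_{v_α}` / `⊗_{α,ℝ}ℂ`). A permutation `σ` of
`A` carries the portion `π∘σ = (v_{σ(α)})_α` onto the portion `π = (v_α)_α` by the FACTOR PERMUTATION of the tensor
product, and so a region `T = (T_π)_π` of the `A`-packet to the region `σ·T` with `(σ·T)_π = perm_σ(T_{π∘σ})`:
* finite `v_ℚ`: campaign-S `permAlgEquiv p s σ : ⊗_α s_{σ α} ≃ₐ[ℚ_p] ⊗_α s_α` (abc-iut-c312-3, `TensorPacketTransport`)
  maps `R_I` onto `R_I` (`image_integerPacket_perm`, here) and `(R_I)^∼` onto `(R_I)^∼` (tree), hence transports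
  the Haar measure normalised at `R_I` and Mochizuki's `μ^log`: **`tensorLogVolume_image_perm : μ^log(perm_σ A) =
  μ^log(A)`** for EVERY `A` (abc-iut-c312-d1's `haar_image_equiv`);
* `v_ℚ = ∞`: the factor permutation `archPermAlgEquiv I V σ` of abc-iut-L5-t7's `M_I = ⊗_{i,ℝ} ⊕_V ℂ` is an
  `ℝ`-algebra automorphism, so `Φ₀ ∘ perm_σ` is another direct sum decomposition and — the log-volume being intrinsic
  (abc-iut `packetLogVol_eq`, `volume_image_eq`, [IUTchIV] Prop. 1.5 (iii) "unique") — **`packetLogVol Φ (perm_σ S) =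
  packetLogVol Φ S`** (`packetLogVol_image_archPerm`) for every `S` and every decomposition `Φ`;
* capsule level: `portionPerm σ : Portion ≃ Portion` (`π ↦ π∘σ`), `permIso σ q π : X_{π∘σ} → X_π`, the permuted region
  `permRegion σ q T`, and **`capsulePacketLogVolume_permRegion : μ^log_{A,v_ℚ}(σ·T) = μ^log_{A,v_ℚ}(T)`** (portion
  weights are symmetric, `portionWeight_portionPerm`; re-index the sum over portions); globally `permGlobalRegion σ S`
  and **`globalLogVolume_permGlobalRegion : μ^log_{A,𝕍_ℚ}(σ·S) = μ^log_{A,𝕍_ℚ}(S)`**.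
With part II (`prop39iii_invariance_haarModelCapsules_general`) this types BOTH symmetries of the printed (iii) at the
genuine model; the divisor-level shadows were abc-iut-L6-d3's `globalLogVolume_capsuleRegionOf(₁)_perm` (p410592 /
p412326).

HONEST SCOPE. As parts I–II (`K = F_mod = F`; `⊗_ℝ` of copies of `ℂ` at `∞`; regions = all positive-finite-volume
subsets). Classical (Haar / Lebesgue measure transport); nothing here bears on [IUTchIII] Cor. 3.12 or takes a side;
typed ≠ endorsed. [cite: DupuyHilado2025, §4.7] [cite: Mochizuki2012, IUTchIV Prop. 1.5 (iii) p. 15]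
-/

noncomputable section

/-! ### Finite `v_ℚ`: the factor permutation transports `R_I` and `μ^log` -/

namespace Literature.IUT.LogVolume

open MeasureTheory Set Module
open scoped ENNReal NNReal Pointwise TensorProduct

section PermVolume

variable (p : ℕ) [Fact p.Prime]
variable {I : Type} [Fintype I] [DecidableEq I]
variable (s : I → Type) [∀ i, NontriviallyNormedField (s i)] [∀ i, NormedAlgebra ℚ_[p] (s i)]
  [∀ i, IsUltrametricDist (s i)] [∀ i, ProperSpace (s i)]
variable (σ : Equiv.Perm I)

omit [Fintype I] [DecidableEq I] [∀ i, IsUltrametricDist (s i)] [∀ i, ProperSpace (s i)] in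
/-- The generating pure tensors of `R_I` (`⊗ x_i`, `‖x_i‖ ≤ 1`) correspond under the factor permutation.
[cite: DupuyHilado2025, §4.7] -/
theorem image_integerPacket_generators_perm :
    permAlgEquiv p s σ '' {t | ∃ z : Π i, s (σ i), (∀ i, ‖z i‖ ≤ 1) ∧ t = purePacket p (fun i ↦ s (σ i)) z} =
      {t | ∃ x : Π i, s i, (∀ i, ‖x i‖ ≤ 1) ∧ t = purePacket p s x} := by
  ext t
  constructor
  · rintro ⟨_, ⟨z, hz, rfl⟩, rfl⟩
    refine ⟨Equiv.piCongrLeft s σ z, fun b => ?_, permAlgEquiv_purePacket p s σ z⟩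
    obtain ⟨a, rfl⟩ := σ.surjective b
    rw [Equiv.piCongrLeft_apply_apply]
    exact hz a
  · rintro ⟨x, hx, rfl⟩
    refine ⟨purePacket p (fun i ↦ s (σ i)) (fun a => x (σ a)), ⟨_, fun a => hx (σ a), rfl⟩, ?_⟩
    rw [permAlgEquiv_purePacket]
    congr 1
    funext b
    obtain ⟨a, rfl⟩ := σ.surjective b
    rw [Equiv.piCongrLeft_apply_apply]

omit [Fintype I] [DecidableEq I] [∀ i, IsUltrametricDist (s i)] [∀ i, ProperSpace (s i)] in
/-- **(Ind1) maps `R_I` onto `R_I`**: `perm_σ(⊗_i R_{σ(i)}) = ⊗_i R_i` (a ring isomorphism maps the subring generated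
by a set onto the subring generated by its image). [cite: DupuyHilado2025, §4.7] -/
theorem image_integerPacket_perm :
    permAlgEquiv p s σ '' (integerPacket p (fun i ↦ s (σ i)) : Set (PacketAlgebra p (fun i ↦ s (σ i)))) =
      integerPacket p s := by
  have h := RingHom.map_closure
    ((permAlgEquiv p s σ : PacketAlgebra p (fun i ↦ s (σ i)) ≃ₐ[ℚ_[p]] PacketAlgebra p s) :
      PacketAlgebra p (fun i ↦ s (σ i)) →+* PacketAlgebra p s)
    {t | ∃ z : Π i, s (σ i), (∀ i, ‖z i‖ ≤ 1) ∧ t = purePacket p (fun i ↦ s (σ i)) z}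
  have h' := congrArg (fun H : Subring (PacketAlgebra p s) => (H : Set (PacketAlgebra p s))) h
  simp only [Subring.coe_map] at h'
  rw [integerPacket, integerPacket, ← image_integerPacket_generators_perm p s σ]
  exact h'

omit [Fintype I] [DecidableEq I] [∀ i, IsUltrametricDist (s i)] [∀ i, ProperSpace (s i)] in
/-- The two packets have the same `ℚ_p`-dimension. [cite: DupuyHilado2025, §4.7] -/
theorem finrank_perm_eq :
    finrank ℚ_[p] (PacketAlgebra p (fun i ↦ s (σ i))) = finrank ℚ_[p] (PacketAlgebra p s) :=
  (permAlgEquiv p s σ).toLinearEquiv.finrank_eq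

/-- **The factor permutation is a homeomorphism** (as an additive isomorphism): both packets carry the module
topology, for which `ℚ_p`-linear maps are continuous. [cite: DupuyHilado2025, §4.7] -/
def permPacketEquiv : PacketAlgebra p (fun i ↦ s (σ i)) ≃ₜ+ PacketAlgebra p s :=
  haveI : ContinuousAdd (PacketAlgebra p (fun i ↦ s (σ i))) := IsModuleTopology.toContinuousAdd ℚ_[p] _
  haveI : ContinuousAdd (PacketAlgebra p s) := IsModuleTopology.toContinuousAdd ℚ_[p] _
  { (permAlgEquiv p s σ).toLinearEquiv.toAddEquiv with
    continuous_toFun :=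
      IsModuleTopology.continuous_of_linearMap (permAlgEquiv p s σ).toLinearEquiv.toLinearMap
    continuous_invFun :=
      IsModuleTopology.continuous_of_linearMap (permAlgEquiv p s σ).toLinearEquiv.symm.toLinearMap }

omit [Fintype I] [DecidableEq I] [∀ i, IsUltrametricDist (s i)] [∀ i, ProperSpace (s i)] in
/-- `permPacketEquiv` and `permAlgEquiv` have the same image sets. [cite: DupuyHilado2025, §4.7] -/
theorem image_permPacketEquiv (A : Set (PacketAlgebra p (fun i ↦ s (σ i)))) :
    permPacketEquiv p s σ '' A = permAlgEquiv p s σ '' A := rfl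

variable [Nonempty I]

/-- **Haar transport under (Ind1)**: `μ_{R_I}(perm_σ(A)) = μ_{R_I}(A)` for EVERY `A` (the Haar measures normalised at
`⊗ R_{σ(i)}` and `⊗ R_i` correspond, abc-iut-c312-d1's `haar_image_equiv`). [cite: DupuyHilado2025, §4.7] -/
theorem haar_image_perm (A : Set (PacketAlgebra p (fun i ↦ s (σ i)))) :
    (integerStructure p s).haar (permAlgEquiv p s σ '' A) = (integerStructure p (fun i ↦ s (σ i))).haar A := by
  rw [← image_permPacketEquiv]
  exact (integerStructure p (fun i ↦ s (σ i))).haar_image_equiv (integerStructure p s) (permPacketEquiv p s σ)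
    (by rw [image_permPacketEquiv, coe_integerStructure, coe_integerStructure, image_integerPacket_perm p s σ]) A

/-- **Mochizuki's `μ^log` is invariant under the factor permutation**: `μ^log_{⊗ s}(perm_σ(A)) = μ^log_{⊗ s∘σ}(A)` for
EVERY `A` — same normalised Haar measure, same shift (`(R_I)^∼ ↦ (R_I)^∼`, `image_normalizedPacket_perm`), same
dimension. ([IUTchIII] Prop. 3.9 (i) "invariant with respect to permutations of `A`", one portion at a time;
Dupuy–Hilado (Ind1) "fixes the lattice".) [claim: Mochizuki2012, status: disputed] -/
theorem tensorLogVolume_image_perm (A : Set (PacketAlgebra p (fun i ↦ s (σ i)))) :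
    tensorLogVolume p s (permAlgEquiv p s σ '' A) = tensorLogVolume p (fun i ↦ s (σ i)) A := by
  unfold tensorLogVolume IntegralStructure.normalizedLogVolume IntegralStructure.logVolume
  rw [haar_image_perm p s σ A, ← image_normalizedPacket_perm p s σ, haar_image_perm p s σ, finrank_perm_eq p s σ]

end PermVolume

/-! ### `v_ℚ = ∞`: the factor permutation of `M_I` and the intrinsic log-volume -/

namespace Prop15iii

open PiTensorProduct ArchPacket

section ArchPerm

variable (I V : Type) (σ : Equiv.Perm I)

/-- The factor permutation of `M_I = ⊗_{i,ℝ} ⊕_V ℂ` as a LINEAR automorphism (inverse of Mathlib's re-indexing along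
`σ⁻¹`). [cite: Mochizuki2012, IUTchIV Prop. 1.5 (iii) p. 15] -/
def archPermLinearEquiv : MI I V ≃ₗ[ℝ] MI I V :=
  (PiTensorProduct.reindex ℝ (fun _ : I => M V) σ.symm).symm

/-- `reindex σ⁻¹ ∘ perm = id`. [cite: Mochizuki2012, IUTchIV Prop. 1.5 (iii) p. 15] -/
theorem reindex_archPermLinearEquiv_apply (x : MI I V) :
    PiTensorProduct.reindex ℝ (fun _ : I => M V) σ.symm (archPermLinearEquiv I V σ x) = x :=
  (PiTensorProduct.reindex ℝ (fun _ : I => M V) σ.symm).apply_symm_apply x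

/-- On pure tensors: `perm(⊗_a z_a) = ⊗_b z_{σ⁻¹ b}` (written with `Equiv.piCongrLeft`).
[cite: Mochizuki2012, IUTchIV Prop. 1.5 (iii) p. 15] -/
theorem archPermLinearEquiv_tprod (z : I → M V) :
    archPermLinearEquiv I V σ (PiTensorProduct.tprod ℝ z) = PiTensorProduct.tprod ℝ (Equiv.piCongrLeft (fun _ : I => M V) σ z) := by
  apply (PiTensorProduct.reindex ℝ (fun _ : I => M V) σ.symm).injective
  refine (reindex_archPermLinearEquiv_apply I V σ _).trans ?_
  refine Eq.trans ?_
    (PiTensorProduct.reindex_tprod (R := ℝ) (s := fun _ : I => M V) σ.symm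
      (Equiv.piCongrLeft (fun _ : I => M V) σ z)).symm
  exact congrArg (PiTensorProduct.tprod ℝ) (funext fun a => (Equiv.piCongrLeft_apply_apply (fun _ : I => M V) σ z a).symm)

/-- The re-indexing is multiplicative. [cite: Mochizuki2012, IUTchIV Prop. 1.5 (iii) p. 15] -/
theorem reindex_symm_map_mul_arch (x y : MI I V) :
    PiTensorProduct.reindex ℝ (fun _ : I => M V) σ.symm (x * y) =
      PiTensorProduct.reindex ℝ (fun _ : I => M V) σ.symm x *
        PiTensorProduct.reindex ℝ (fun _ : I => M V) σ.symm y := by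
  induction x using PiTensorProduct.induction_on with
  | smul_tprod r f =>
    induction y using PiTensorProduct.induction_on with
    | smul_tprod r' g =>
      rw [PiTensorProduct.smul_tprod_mul_smul_tprod, map_smul, map_smul, map_smul,
        PiTensorProduct.reindex_tprod, PiTensorProduct.reindex_tprod, PiTensorProduct.reindex_tprod,
        PiTensorProduct.smul_tprod_mul_smul_tprod]
      rfl
    | add a b ha hb => rw [mul_add, map_add, ha, hb, map_add, mul_add]
  | add a b ha hb => rw [add_mul, map_add, ha, hb, map_add, add_mul]

/-- Hence so is the factor permutation. [cite: Mochizuki2012, IUTchIV Prop. 1.5 (iii) p. 15] -/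
theorem archPermLinearEquiv_map_mul (x y : MI I V) :
    archPermLinearEquiv I V σ (x * y) = archPermLinearEquiv I V σ x * archPermLinearEquiv I V σ y := by
  apply (PiTensorProduct.reindex ℝ (fun _ : I => M V) σ.symm).injective
  refine (reindex_archPermLinearEquiv_apply I V σ _).trans ?_
  refine Eq.trans ?_ (reindex_symm_map_mul_arch I V σ _ _).symm
  exact congrArg₂ (· * ·) (reindex_archPermLinearEquiv_apply I V σ x).symm
    (reindex_archPermLinearEquiv_apply I V σ y).symm

/-- `perm(1) = 1`. [cite: Mochizuki2012, IUTchIV Prop. 1.5 (iii) p. 15] -/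
theorem archPermLinearEquiv_map_one : archPermLinearEquiv I V σ 1 = 1 := by
  have h : (1 : MI I V) = PiTensorProduct.tprod ℝ 1 := PiTensorProduct.one_def
  rw [h, archPermLinearEquiv_tprod]
  refine congrArg (PiTensorProduct.tprod ℝ) (funext fun b => ?_)
  obtain ⟨a, rfl⟩ := σ.surjective b
  rw [Equiv.piCongrLeft_apply_apply]
  rfl

/-- **The factor permutation of `M_I` as an `ℝ`-ALGEBRA automorphism** ("automorphisms of `M_I`" permuting the tensor
factors — the archimedean (Ind1)). [cite: Mochizuki2012, IUTchIV Prop. 1.5 (iii) p. 15] -/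
def archPermAlgEquiv : MI I V ≃ₐ[ℝ] MI I V :=
  AlgEquiv.ofLinearEquiv (archPermLinearEquiv I V σ) (archPermLinearEquiv_map_one I V σ)
    (archPermLinearEquiv_map_mul I V σ)

/-- `archPermAlgEquiv` acts as `archPermLinearEquiv`. [cite: Mochizuki2012, IUTchIV Prop. 1.5 (iii) p. 15] -/
@[simp] theorem archPermAlgEquiv_apply (x : MI I V) : archPermAlgEquiv I V σ x = archPermLinearEquiv I V σ x := rfl

variable {I V} {J : Type} [Fintype J] [DecidableEq J]

/-- **The volume in any decomposition is invariant under the factor permutation**: `Φ ∘ perm_σ` is again a direct sum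
decomposition of `M_I`, and the volume of the image of a set is the same in every decomposition (`volume_image_eq`,
[IUTchIV] Prop. 1.5 (iii) "unique"). [claim: Mochizuki2012, status: disputed] -/
theorem volume_image_archPerm (Φ : Decomposition I V J) (S : Set (MI I V)) :
    volume ((Φ : MI I V → (J → ℂ)) '' (archPermAlgEquiv I V σ '' S)) = volume ((Φ : MI I V → (J → ℂ)) '' S) := by
  have h : (Φ : MI I V → (J → ℂ)) '' (archPermAlgEquiv I V σ '' S) =
      (((archPermAlgEquiv I V σ).trans Φ : Decomposition I V J) : MI I V → (J → ℂ)) '' S := by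
    rw [Set.image_image]
    rfl
  rw [h]
  exact volume_image_eq Φ ((archPermAlgEquiv I V σ).trans Φ) S

/-- **The packet log-volume is invariant under the factor permutation**: `packetLogVol Φ (perm_σ S) = packetLogVol Φ S`
for every `S ⊆ M_I` and every decomposition `Φ` (`packetLogVol_eq`: the log-volume of `M_I` is intrinsic).
[claim: Mochizuki2012, status: disputed] -/
theorem packetLogVol_image_archPerm (Φ : Decomposition I V J) (S : Set (MI I V)) :
    packetLogVol Φ (archPermAlgEquiv I V σ '' S) = packetLogVol Φ S := by
  have h : (Φ : MI I V → (J → ℂ)) '' (archPermAlgEquiv I V σ '' S) =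
      (((archPermAlgEquiv I V σ).trans Φ : Decomposition I V J) : MI I V → (J → ℂ)) '' S := by
    rw [Set.image_image]
    rfl
  rw [packetLogVol, h]
  exact packetLogVol_eq ((archPermAlgEquiv I V σ).trans Φ) Φ S

end ArchPerm

end Prop15iii

end Literature.IUT.LogVolume

/-! ### The capsule level: permuting `A` -/

namespace Literature.IUT.LogThetaLattice

open Literature.IUT.LogVolume Literature.IUT.LogVolume.Prop15iii NumberField IsDedekindDomain MeasureTheory Set
open scoped ENNReal NNReal

variable (F : Type) [Field F] [NumberField F]
variable (A : Type) [Fintype A] [DecidableEq A] [Nonempty A]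

/-- **Permuting the labels of a portion**: `σ·π := π ∘ σ = (v_{σ(α)})_α` (a bijection of the portions).
[claim: Mochizuki2012, status: disputed] -/
def portionPerm (q : RatPlace) (σ : Equiv.Perm A) : Portion F A q ≃ Portion F A q where
  toFun π := fun α => π (σ α)
  invFun π := fun α => π (σ.symm α)
  left_inv π := funext fun α => by simp
  right_inv π := funext fun α => by simp

omit [NumberField F] [Fintype A] [DecidableEq A] [Nonempty A] in
/-- `(σ·π) α = π (σ α)`. [claim: Mochizuki2012, status: disputed] -/
@[simp] theorem portionPerm_apply (q : RatPlace) (σ : Equiv.Perm A) (π : Portion F A q) (α : A) :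
    portionPerm F A q σ π α = π (σ α) := rfl

omit [DecidableEq A] [Nonempty A] in
/-- **The portion weights are symmetric**: `portionWeight(π ∘ σ) = portionWeight(π)` (a product over `A`, re-indexed).
[claim: Mochizuki2012, status: disputed] -/
theorem portionWeight_portionPerm (q : RatPlace) (σ : Equiv.Perm A) (π : Portion F A q) :
    portionWeight F A q (portionPerm F A q σ π) = portionWeight F A q π := by
  unfold portionWeight
  simp only [portionPerm_apply]
  exact Equiv.prod_comp σ (fun β => placeProbWeight F (π β).1)

/-- **The factor permutation of the portion carriers**, `X_{σ·π} → X_π`: at `∞` the `ℝ`-algebra automorphism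
`archPermAlgEquiv` of `⊗_{α,ℝ}ℂ`; at `p` campaign-S's `permAlgEquiv` from `⊗_α F_{v_{σ α}}` onto `⊗_α F_{v_α}`.
[claim: Mochizuki2012, status: disputed] -/
def permIso (σ : Equiv.Perm A) :
    (q : RatPlace) → (π : Portion F A q) → (portionDatum F A q (portionPerm F A q σ π)).X → (portionDatum F A q π).X
  | Sum.inl (), _ => fun x => archPermAlgEquiv A Unit σ x
  | Sum.inr p, π => fun x =>
      haveI : Fact (p : ℕ).Prime := ⟨p.2⟩
      permAlgEquiv p (fun β => Kp F p (packetPrimeEquiv F p (π β))) σ x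

/-- The factor permutation preserves admissibility (positive finite volume). [claim: Mochizuki2012, status: disputed] -/
theorem isAdm_image_permIso (σ : Equiv.Perm A) (q : RatPlace) (π : Portion F A q)
    {T : Set (portionDatum F A q (portionPerm F A q σ π)).X}
    (hT : (portionDatum F A q (portionPerm F A q σ π)).IsAdm T) :
    (portionDatum F A q π).IsAdm (permIso F A σ q π '' T) := by
  rcases q with ⟨⟩ | p
  · haveI : Nonempty Unit := ⟨()⟩
    change volume ((canonicalDecomposition A Unit : MI A Unit → (Idx A Unit → ℂ)) ''
        ((fun x => archPermAlgEquiv A Unit σ x) '' T)) ≠ 0 ∧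
      volume ((canonicalDecomposition A Unit : MI A Unit → (Idx A Unit → ℂ)) ''
        ((fun x => archPermAlgEquiv A Unit σ x) '' T)) ≠ ∞
    rw [show (fun x => archPermAlgEquiv A Unit σ x) '' T = archPermAlgEquiv A Unit σ '' T from rfl,
      volume_image_archPerm]
    exact hT
  · haveI : Fact (p : ℕ).Prime := ⟨p.2⟩
    change 0 < (integerStructure p (fun β => Kp F p (packetPrimeEquiv F p (π β)))).haar
        ((fun x => permAlgEquiv p (fun β => Kp F p (packetPrimeEquiv F p (π β))) σ x) '' T) ∧
      (integerStructure p (fun β => Kp F p (packetPrimeEquiv F p (π β)))).haar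
        ((fun x => permAlgEquiv p (fun β => Kp F p (packetPrimeEquiv F p (π β))) σ x) '' T) < ∞
    rw [show (fun x => permAlgEquiv p (fun β => Kp F p (packetPrimeEquiv F p (π β))) σ x) '' T =
        permAlgEquiv p (fun β => Kp F p (packetPrimeEquiv F p (π β))) σ '' T from rfl, haar_image_perm]
    exact hT

/-- **The factor permutation preserves the portion log-volume**: `μ^log_π(perm_σ T) = μ^log_{σ·π}(T)`.
[claim: Mochizuki2012, status: disputed] -/
theorem logVol_image_permIso (σ : Equiv.Perm A) (q : RatPlace) (π : Portion F A q)
    (T : Set (portionDatum F A q (portionPerm F A q σ π)).X) :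
    (portionDatum F A q π).logVol (permIso F A σ q π '' T) =
      (portionDatum F A q (portionPerm F A q σ π)).logVol T := by
  rcases q with ⟨⟩ | p
  · change packetLogVol (canonicalDecomposition A Unit) ((fun x => archPermAlgEquiv A Unit σ x) '' T) =
      packetLogVol (canonicalDecomposition A Unit) T
    exact packetLogVol_image_archPerm σ (canonicalDecomposition A Unit) T
  · haveI : Fact (p : ℕ).Prime := ⟨p.2⟩
    change tensorLogVolume p (fun β => Kp F p (packetPrimeEquiv F p (π β)))
        ((fun x => permAlgEquiv p (fun β => Kp F p (packetPrimeEquiv F p (π β))) σ x) '' T) =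
      tensorLogVolume p (fun α => Kp F p (packetPrimeEquiv F p (π (σ α)))) T
    exact tensorLogVolume_image_perm p (fun β => Kp F p (packetPrimeEquiv F p (π β))) σ T

/-- **The permuted region** `σ·T` of the `A`-packet at `v_ℚ`: `(σ·T)_π := perm_σ(T_{σ·π})`.
[claim: Mochizuki2012, status: disputed] -/
def permRegion (σ : Equiv.Perm A) (q : RatPlace) (T : ∀ π : Portion F A q, (portionDatum F A q π).Adm) :
    ∀ π : Portion F A q, (portionDatum F A q π).Adm :=
  fun π => ⟨permIso F A σ q π '' (T (portionPerm F A q σ π)).1,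
    isAdm_image_permIso F A σ q π (T (portionPerm F A q σ π)).2⟩

/-- **[IUTchIII] Prop. 3.9 (i) at the genuine model: `μ^log_{A,v_ℚ}` is invariant with respect to permutations of `A`**
— `μ^log_{A,v_ℚ}(σ·T) = μ^log_{A,v_ℚ}(T)` for every region `T` of the `A`-packet at `v_ℚ` and every `σ ∈ 𝔖_A`
(portion log-volumes transported, weights symmetric, sum over portions re-indexed). [claim: Mochizuki2012, status: disputed] -/
theorem capsulePacketLogVolume_permRegion (σ : Equiv.Perm A) (q : RatPlace)
    (T : ∀ π : Portion F A q, (portionDatum F A q π).Adm) :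
    capsulePacketLogVolume F A q (permRegion F A σ q T) = capsulePacketLogVolume F A q T := by
  unfold capsulePacketLogVolume
  have h : ∀ π : Portion F A q,
      portionWeight F A q π * (portionDatum F A q π).logVol (permRegion F A σ q T π).1 =
        portionWeight F A q (portionPerm F A q σ π) *
          (portionDatum F A q (portionPerm F A q σ π)).logVol (T (portionPerm F A q σ π)).1 := by
    intro π
    rw [portionWeight_portionPerm]
    exact congrArg _ (logVol_image_permIso F A σ q π _)
  simp_rw [h]
  exact Equiv.sum_comp (portionPerm F A q σ)
    (fun π => portionWeight F A q π * (portionDatum F A q π).logVol (T π).1)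

/-- **The permuted GLOBAL region** `σ·S` (same packet log-volumes, hence still "zero for all but finitely many `v_ℚ`").
[claim: Mochizuki2012, status: disputed] -/
def permGlobalRegion (σ : Equiv.Perm A) (S : GlobalRegion (capsulePacketLogVolume F A)) :
    GlobalRegion (capsulePacketLogVolume F A) :=
  ⟨fun q => permRegion F A σ q (S.1 q), by
    refine S.2.subset fun q hq => ?_
    rw [Function.mem_support, capsulePacketLogVolume_permRegion] at hq
    exact Function.mem_support.mpr hq⟩

/-- **IUTchIII:Prop3.9(iii)** (kurims p. 117) PERMUTATION CLAUSE AT THE GENUINE MODEL: the global log-volume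
`μ^log_{A,𝕍_ℚ}` is "invariant … with respect to permutations of `A`" — `μ^log_{A,𝕍_ℚ}(σ·S) = μ^log_{A,𝕍_ℚ}(S)` for every
global region `S` of the genuine `A`-packets and every `σ ∈ 𝔖_A`. [claim: Mochizuki2012, status: disputed] -/
theorem globalLogVolume_permGlobalRegion (σ : Equiv.Perm A) (S : GlobalRegion (capsulePacketLogVolume F A)) :
    globalLogVolume (capsulePacketLogVolume F A) (permGlobalRegion F A σ S) =
      globalLogVolume (capsulePacketLogVolume F A) S := by
  unfold globalLogVolume
  exact finsum_congr fun q => capsulePacketLogVolume_permRegion F A σ q (S.1 q)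

/-- **Both symmetries of (iii) together**: the global log-volume is invariant under permuting the labels AND
multiplying by `f ∈ F^×` in any label (part II `globalLogVolume_capsulePacketAction`).
[claim: Mochizuki2012, status: disputed] -/
theorem globalLogVolume_permGlobalRegion_capsulePacketAction (σ : Equiv.Perm A) (α : A) (f : Fˣ)
    (S : GlobalRegion (capsulePacketLogVolume F A)) :
    globalLogVolume (capsulePacketLogVolume F A) (permGlobalRegion F A σ (capsulePacketAction F A α f S)) =
      globalLogVolume (capsulePacketLogVolume F A) S := by
  rw [globalLogVolume_permGlobalRegion, globalLogVolume_capsulePacketAction]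

end Literature.IUT.LogThetaLattice

end
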